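import Mathlib

/-!
# PercRepro — deleting the coloops of an `e`-free matroid gives an `e`-free, coloop-free matroid (night-1, gen 3)

`proofs/NIGHT-1-C025-induction.md` §14.18. The wrappers' core with coloops allowed (`rls_succ_large`) and the cell's
coloop-free `Core` are one element-set apart: for a matroid `M` in which every element has an `e`-free partition,
`M ＼ M.coloops` still has `e`-free partitions (`free_delete_coloops`), is coloop-free (`not_isColoop_delete_coloops`),
loopless (`not_isLoop_delete_coloops`), keeps the ranks of sets of non-coloops (`eRk_delete_coloops_eq`), and coloops
add rank freely (`eRk_union_eq_of_subset_coloops`: `r(X ∪ K) = r(X) + |K|`), so its rank is `r(M) − #coloops`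
(`eRank_delete_coloops_add`). So Core-form statements
(night-3's flat bounds, p2's `card_le_ten_of_core`, …) transfer to the coloop-allowed core by deleting the coloops.
Mathlib only. Axioms: standard.
-/

open scoped Matroid

namespace PercRepro

namespace ThmN

variable {α : Type} {M : Matroid α}

/-- Deleting the coloops keeps every `e`-free partition (closures in `M ＼ K` are closures in `M` minus `K`, and
coloops never enter a closure of a set avoiding them). -/
theorem free_delete_coloops
    (hfree : ∀ e ∈ M.E, ∃ A ⊆ M.E \ {e}, e ∉ M.closure A ∧ e ∉ M.closure ((M.E \ {e}) \ A)) :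
    ∀ e ∈ (M ＼ M.coloops).E, ∃ A ⊆ (M ＼ M.coloops).E \ {e},
      e ∉ (M ＼ M.coloops).closure A ∧ e ∉ (M ＼ M.coloops).closure (((M ＼ M.coloops).E \ {e}) \ A) := by
  intro e he
  rw [Matroid.delete_ground] at he ⊢
  obtain ⟨A, hA, heA, heB⟩ := hfree e he.1
  refine ⟨A \ M.coloops, ?_, ?_, ?_⟩
  · intro x hx
    exact ⟨⟨(hA hx.1).1, hx.2⟩, (hA hx.1).2⟩
  · rw [Matroid.delete_closure_eq]
    intro h
    exact heA (M.closure_subset_closure (Set.sdiff_subset.trans Set.sdiff_subset) h.1)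
  · rw [Matroid.delete_closure_eq]
    intro h
    refine heB (M.closure_subset_closure ?_ h.1)
    intro x hx
    exact ⟨⟨hx.1.1.1.1, hx.1.1.2⟩, fun hxA => hx.1.2 ⟨hxA, hx.1.1.1.2⟩⟩

/-- `M ＼ M.coloops` has no coloops: an element outside the coloops lies in the closure of the rest, and the coloops
drop out of that closure. -/
theorem not_isColoop_delete_coloops (M : Matroid α) : ∀ e, ¬ (M ＼ M.coloops).IsColoop e := by
  intro e he
  rw [Matroid.delete_isColoop_iff] at he
  obtain ⟨hcl, heE, heC⟩ := he
  have hnc : ¬ M.IsColoop e := fun h => heC h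
  rw [Matroid.isColoop_iff_notMem_closure_compl heE, not_not] at hnc
  have h1 : M.closure (M.E \ {e}) = M.closure ((M.E \ M.coloops) \ {e}) ∪ M.coloops := by
    have h2 : M.E \ {e} = ((M.E \ M.coloops) \ {e}) ∪ M.coloops := by
      ext x
      simp only [Set.mem_sdiff, Set.mem_singleton_iff, Set.mem_union]
      constructor
      · rintro ⟨hxE, hxe⟩
        by_cases hxc : x ∈ M.coloops
        · exact Or.inr hxc
        · exact Or.inl ⟨⟨hxE, hxc⟩, hxe⟩
      · rintro (⟨⟨hxE, -⟩, hxe⟩ | hxc)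
        · exact ⟨hxE, hxe⟩
        · refine ⟨Matroid.IsColoop.mem_ground hxc, ?_⟩
          rintro rfl; exact heC hxc
    rw [h2, Matroid.closure_union_eq_of_subset_coloops _ subset_rfl]
  rw [h1] at hnc
  rcases hnc with h | h
  · exact hcl h
  · exact heC h

/-- Deleting the coloops keeps looplessness. -/
theorem not_isLoop_delete_coloops (hL : ∀ e ∈ M.E, ¬ M.IsLoop e) :
    ∀ e ∈ (M ＼ M.coloops).E, ¬ (M ＼ M.coloops).IsLoop e := by
  intro e he hloop
  rw [Matroid.delete_ground] at he
  rw [Matroid.isLoop_iff, Matroid.loops, Matroid.delete_closure_eq] at hloop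
  exact hL e he.1 (Matroid.isLoop_iff.2 (by
    rw [Matroid.loops]
    have : M.closure (∅ \ M.coloops) = M.closure ∅ := by rw [Set.empty_sdiff]
    rw [this] at hloop
    exact hloop.1))

/-- Deleting the coloops keeps the rank of every set of non-coloops of `E`. -/
theorem eRk_delete_coloops_eq {X : Set α} (hX : X ⊆ M.E \ M.coloops) :
    (M ＼ M.coloops).eRk X = M.eRk X := by
  rw [Matroid.delete_eq_restrict, Matroid.restrict_eRk_eq _ hX]

/-- **Coloops add rank freely**: for `K ⊆ coloops` disjoint from `X ⊆ E`, `r(X ∪ K) = r(X) + |K|` (a basis of `X`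
together with `K` is a basis of `X ∪ K`). -/
theorem eRk_union_eq_of_subset_coloops {X K : Set α} (hX : X ⊆ M.E) (hK : K ⊆ M.coloops)
    (hXK : Disjoint X K) : M.eRk (X ∪ K) = M.eRk X + K.encard := by
  obtain ⟨I, hI⟩ := M.exists_isBasis X hX
  have hIK : M.Indep (I ∪ K) := (Matroid.union_indep_iff_indep_of_subset_coloops hK).2 hI.indep
  have hB : M.IsBasis (I ∪ K) (X ∪ K) := by
    refine hIK.isBasis_of_subset_of_subset_closure (Set.union_subset_union_left K hI.subset) ?_
    rw [Matroid.closure_union_eq_of_subset_coloops _ hK]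
    exact Set.union_subset_union_left K hI.subset_closure
  rw [← hB.encard_eq_eRk, ← hI.encard_eq_eRk]
  exact Set.encard_union_eq (Set.disjoint_of_subset_left hI.subset hXK)

/-- The rank of `M ＼ M.coloops` plus the number of coloops is the rank of `M`. -/
theorem eRank_delete_coloops_add (M : Matroid α) :
    (M ＼ M.coloops).eRank + M.coloops.encard = M.eRank := by
  rw [Matroid.eRank_def, Matroid.eRank_def, Matroid.delete_ground]
  have h1 : (M ＼ M.coloops).eRk (M.E \ M.coloops) = M.eRk (M.E \ M.coloops) :=
    eRk_delete_coloops_eq subset_rfl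
  rw [h1, ← eRk_union_eq_of_subset_coloops Set.sdiff_subset subset_rfl Set.disjoint_sdiff_left,
    Set.sdiff_union_of_subset M.coloops_subset_ground]

/-- `b (k − j) + j ≤ b k` for a bound function with `b j + 1 ≤ b (j + 1)` below `k`. -/
theorem bound_sub_add_le (b : ℕ → ℕ) (k : ℕ) (hb : ∀ j, j < k → b j + 1 ≤ b (j + 1)) :
    ∀ j, j ≤ k → b (k - j) + j ≤ b k := by
  intro j
  induction j with
  | zero => intro _; simp
  | succ j ih =>
    intro hj
    have h1 := ih (by omega)
    have h2 := hb (k - (j + 1)) (by omega)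
    have h3 : k - (j + 1) + 1 = k - j := by omega
    rw [h3] at h2
    omega

/-- **Flat bounds transfer from the non-coloops to the whole matroid**: if every set of non-coloops of rank `≤ j`
has at most `b j` points (`j ≤ k`, `b` growing by at least one per rank), then every `F ⊆ E` of rank `≤ k` has at
most `b k` points — the coloops of `F` add one point and one rank each. -/
theorem ncard_le_of_bound_sdiff_coloops (M : Matroid α) [M.Finite] (b : ℕ → ℕ) (k : ℕ)
    (hb : ∀ j, j < k → b j + 1 ≤ b (j + 1))
    (hB : ∀ j, j ≤ k → ∀ X ⊆ M.E \ M.coloops, M.eRk X ≤ j → X.ncard ≤ b j)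
    {F : Set α} (hF : F ⊆ M.E) (hr : M.eRk F ≤ k) : F.ncard ≤ b k := by
  set X := F \ M.coloops with hX
  set K := F ∩ M.coloops with hK
  have hFfin : F.Finite := M.ground_finite.subset hF
  have hKfin : K.Finite := hFfin.subset Set.inter_subset_left
  have hXfin : X.Finite := hFfin.subset Set.sdiff_subset
  have hXE : X ⊆ M.E \ M.coloops := fun x hx => ⟨hF hx.1, hx.2⟩
  have hunion : X ∪ K = F := by
    ext x; simp only [hX, hK, Set.mem_union, Set.mem_sdiff, Set.mem_inter_iff]; tauto
  have hdisj : Disjoint X K := Set.disjoint_of_subset_right Set.inter_subset_right Set.disjoint_sdiff_left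
  have hrk : M.eRk F = M.eRk X + K.encard := by
    rw [← hunion]
    exact eRk_union_eq_of_subset_coloops (Set.sdiff_subset.trans hF) Set.inter_subset_right hdisj
  have hKn : K.encard = (K.ncard : ℕ∞) := hKfin.cast_ncard_eq.symm
  have hjk : K.ncard ≤ k := by
    have h : (K.ncard : ℕ∞) ≤ k := by
      calc (K.ncard : ℕ∞) ≤ M.eRk X + K.ncard := le_add_self
        _ = M.eRk F := by rw [hrk, hKn]
        _ ≤ k := hr
    exact_mod_cast h
  have hrX : M.eRk X ≤ ((k - K.ncard : ℕ) : ℕ∞) := by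
    have h : M.eRk X + (K.ncard : ℕ∞) ≤ ((k - K.ncard : ℕ) : ℕ∞) + (K.ncard : ℕ∞) := by
      rw [← Nat.cast_add, Nat.sub_add_cancel hjk, ← hKn, ← hrk]; exact hr
    exact (ENat.add_le_add_iff_right (by simp)).1 h
  have hXb : X.ncard ≤ b (k - K.ncard) := hB (k - K.ncard) (by omega) X hXE hrX
  have hFn : F.ncard = X.ncard + K.ncard := by
    rw [← hunion, Set.ncard_union_eq hdisj hXfin hKfin]
  have := bound_sub_add_le b k hb K.ncard hjk
  omega

end ThmN

end PercRepro
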